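import Literature.AlgebraicTopology.SingularHomology.ShuffleChains
import Literature.AlgebraicTopology.SingularHomology.Subdivision
import Literature.AlgebraicTopology.SingularHomology.CupProduct
import HarnessLib

/-!
# The Eilenberg–Zilber shuffle product of singular simplices and the Alexander–Whitney diagonal homotopy

Topic `Literature/AlgebraicTopology/SingularHomology`. Realization of the universal shuffle chains of
`…SingularHomology.ShuffleChains` against singular simplices of a product of spaces
(Eilenberg–Mac Lane 1953, §5; Hatcher, *Algebraic Topology* (2002), §3.B pp. 277–280; Bredon,
*Topology and Geometry* (1993), VI §1 and §4):

* `SingularSimplex.pairSimplex σ τ : Δⁿ → X × Y` — the simplex with components `σ`, `τ`; its faces,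
  affine reparametrisations, front/back faces and push-forwards;
* `EilenbergZilber.realize₂ σ τ` — realization of a tuple chain of lattice points `ℕ × ℕ` against a
  `p`-simplex `σ` of `X` and a `q`-simplex `τ` of `Y`: the tuple `((a₀,b₀), …, (a_k,b_k))` goes to
  the singular simplex `(σ ∘ [e_{a₀}, …, e_{a_k}], τ ∘ [e_{b₀}, …, e_{b_k}])` of `X × Y`; it commutes
  with boundaries, turns the lattice coface maps `δᵢ × 1`, `1 × δⱼ`, `δᵢ × δᵢ` into faces of `σ`, of
  `τ`, of both, the translation `emb p` into "front face ⊗ back face", and the diagonal tuple into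
  the diagonal simplex `(σ, σ)`;
* `EilenbergZilber.ezMap n σ τ` — **the Eilenberg–Zilber / Eilenberg–Mac Lane shuffle product**
  `σ × τ ∈ C_{p+q}(X × Y)` (`n = p + q`), with the boundary formula
  `∂(σ × τ) = ∂σ × τ + (-1)ᵖ σ × ∂τ` (`bd_ezMap_succ_succ`, `…_succ_zero`, `…_zero_succ`) and
  naturality (`map_ezMap`);
* `EilenbergZilber.awMap σ = ∑_{p+q=m} (front_p σ) × (back_q σ) ∈ C_m(X × X)` — the shuffle product
  of the Alexander–Whitney diagonal (`awMap_eq_sum`), a natural chain map (`bd_awMap`);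
* `EilenbergZilber.ezHomotopy σ ∈ C_{m+1}(X × X)` — the natural chain homotopy between the
  diagonal `Δ_* σ = (σ, σ)` and `awMap σ`: `∂ H σ + H ∂σ = (σ,σ) - awMap σ` (`bd_ezHomotopy_succ`,
  `ezHomotopy_zero`, `awMap_zero`), i.e. the Eilenberg–Zilber theorem's comparison of the geometric
  diagonal with the Alexander–Whitney approximation, at the level needed to compare cup products
  with products evaluated on shuffle chains (Hatcher (2002), §3.B, Lemma 3B.2 / Thm. 3B.?; Bredon
  (1993), VI.4.?). Linear extensions to chains: `diagChain`, `awChain`, `ezHChain` with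
  `bd_awChain`, `bd_ezHChain`.

All simplices produced from `σ`, `τ` are of the form `(σ ∘ [vertices], τ ∘ [vertices])` — affine
reparametrisations — so smoothness is preserved on manifolds (recorded in the sequel, not here).
Everything is definitions with bodies and proved lemmas; nothing is asserted. No Eilenberg–Zilber
quasi-isomorphism, no cross product on homology (not needed downstream).

## References

* S. Eilenberg, S. Mac Lane, On the groups `H(Π,n)`. I, Ann. of Math. 58 (1953), §5. [folklore attribution]
* A. Hatcher, *Algebraic Topology*, CUP 2002, §3.B pp. 277–280, §3.2 p. 206. [HatcherAT2002]
* G. E. Bredon, *Topology and Geometry*, GTM 139 (1993), VI §1, §4. [Bredon1993]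
-/

noncomputable section

-- see "Implementation notes" in `…SingularHomology.SingularChainsConcrete`
set_option backward.isDefEq.respectTransparency false

open CategoryTheory AlgebraicTopology

universe u v

namespace Literature.AlgebraicTopology.SingularHomology

open ShuffleChains TupleChain

/-! ### Lattice labels as vertices of the standard simplex -/

namespace StdSimplex

/-- The vertex `e_a` of `Δⁿ` labelled by a natural number `a` (clamped to `n`; only labels `a ≤ n`
are ever used on supports). [folklore] -/
def vtx (n a : ℕ) : StdSimplex n := stdSimplex.vertex ⟨min a n, Nat.lt_succ_of_le (Nat.min_le_right a n)⟩

/-- For `a ≤ n` the label is honest. [folklore] -/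
theorem vtx_eq_vertex {n a : ℕ} (h : a ≤ n) : vtx n a = stdSimplex.vertex ⟨a, Nat.lt_succ_of_le h⟩ := by
  unfold vtx
  congr 1
  exact Fin.ext (Nat.min_eq_left h)

/-- On `Fin (n+1)` the labels are the vertex tuple. [folklore] -/
theorem vtx_val {n : ℕ} (k : Fin (n + 1)) : vtx n (k : ℕ) = stdSimplex.vertex k := by
  rw [vtx_eq_vertex (Nat.lt_succ_iff.mp k.2)]

end StdSimplex

/-! ### Simplices of a product space from their components -/

namespace SingularSimplex

variable {X : Type u} [TopologicalSpace X] {Y : Type u} [TopologicalSpace Y]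
  {X' : Type u} [TopologicalSpace X'] {Y' : Type u} [TopologicalSpace Y'] {n k : ℕ}

/-- **The singular simplex `(σ, τ) : Δⁿ → X × Y` with components `σ` and `τ`.** [folklore] -/
def pairSimplex (σ : SingularSimplex X n) (τ : SingularSimplex Y n) : SingularSimplex (X × Y) n :=
  toContinuousMap.symm ((toContinuousMap σ).prodMk (toContinuousMap τ))

/-- The continuous map of `(σ, τ)`. [folklore] -/
@[simp]
theorem toContinuousMap_pairSimplex (σ : SingularSimplex X n) (τ : SingularSimplex Y n) :
    toContinuousMap (pairSimplex σ τ) = (toContinuousMap σ).prodMk (toContinuousMap τ) :=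
  Equiv.apply_symm_apply _ _

/-- Faces of `(σ, τ)` are `(σ ∘ δᵢ, τ ∘ δᵢ)`. [folklore] -/
theorem pairSimplex_face (σ : SingularSimplex X (n + 1)) (τ : SingularSimplex Y (n + 1)) (i : Fin (n + 2)) :
    (pairSimplex σ τ).face i = pairSimplex (σ.face i) (τ.face i) := by
  apply toContinuousMap_injective
  rw [toContinuousMap_face, toContinuousMap_pairSimplex, toContinuousMap_pairSimplex, toContinuousMap_face,
    toContinuousMap_face]
  rfl

/-- Affine reparametrisations of `(σ, τ)` are `(σ ∘ [w], τ ∘ [w])`. [folklore] -/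
theorem pairSimplex_compose (σ : SingularSimplex X n) (τ : SingularSimplex Y n) (w : Fin (k + 1) → StdSimplex n) :
    (pairSimplex σ τ).compose w = pairSimplex (σ.compose w) (τ.compose w) := by
  apply toContinuousMap_injective
  rw [toContinuousMap_compose, toContinuousMap_pairSimplex, toContinuousMap_pairSimplex, toContinuousMap_compose,
    toContinuousMap_compose]
  rfl

/-- Push-forward of `(σ, τ)` along a product map `f × g` is `(f ∘ σ, g ∘ τ)`. [folklore] -/
theorem pairSimplex_map_prodMap (σ : SingularSimplex X n) (τ : SingularSimplex Y n) (f : C(X, X')) (g : C(Y, Y')) :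
    (pairSimplex σ τ).map (f.prodMap g) = pairSimplex (σ.map f) (τ.map g) := by
  apply toContinuousMap_injective
  rw [toContinuousMap_map, toContinuousMap_pairSimplex, toContinuousMap_pairSimplex, toContinuousMap_map,
    toContinuousMap_map]
  rfl

/-- The first component of `(σ, τ)`. [folklore] -/
theorem pairSimplex_map_fst (σ : SingularSimplex X n) (τ : SingularSimplex Y n) :
    (pairSimplex σ τ).map ⟨Prod.fst, continuous_fst⟩ = σ := by
  apply toContinuousMap_injective
  rw [toContinuousMap_map, toContinuousMap_pairSimplex]
  rfl

/-- The second component of `(σ, τ)`. [folklore] -/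
theorem pairSimplex_map_snd (σ : SingularSimplex X n) (τ : SingularSimplex Y n) :
    (pairSimplex σ τ).map ⟨Prod.snd, continuous_snd⟩ = τ := by
  apply toContinuousMap_injective
  rw [toContinuousMap_map, toContinuousMap_pairSimplex]
  rfl

/-- The diagonal simplex `(σ, σ)` is the push-forward of `σ` along the diagonal map. [folklore] -/
theorem pairSimplex_self (σ : SingularSimplex X n) :
    pairSimplex σ σ = σ.map (⟨fun x ↦ (x, x), continuous_id.prodMk continuous_id⟩ : C(X, X × X)) := by
  apply toContinuousMap_injective
  rw [toContinuousMap_map, toContinuousMap_pairSimplex]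
  rfl

/-- `(f ∘ σ) ∘ [w] = f ∘ (σ ∘ [w])`. [folklore] -/
theorem compose_map (σ : SingularSimplex X n) (f : C(X, X')) (w : Fin (k + 1) → StdSimplex n) :
    (σ.map f).compose w = (σ.compose w).map f := by
  apply toContinuousMap_injective
  rw [toContinuousMap_compose, toContinuousMap_map, toContinuousMap_map, toContinuousMap_compose]
  rfl

/-- The front face as a restriction along the inert map of standard simplices (the `rfl` lemma
`toContinuousMap_frontFace` of `…UniverseTransportCap`, restated to keep the imports light). [folklore] -/
theorem toContinuousMap_frontFace_eq_comp {p : ℕ} (h : p ≤ n) (σ : SingularSimplex X n) :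
    toContinuousMap (σ.frontFace h) =
      (toContinuousMap σ).comp ⟨stdSimplex.map (SimplexCategory.subinterval 0 p (by omega)).toOrderHom,
        stdSimplex.continuous_map _⟩ :=
  rfl

/-- The back face as a restriction along the inert map of standard simplices (the `rfl` lemma
`toContinuousMap_backFace` of `…UniverseTransportCap`, restated to keep the imports light). [folklore] -/
theorem toContinuousMap_backFace_eq_comp {q : ℕ} (h : q ≤ n) (σ : SingularSimplex X n) :
    toContinuousMap (σ.backFace h) =
      (toContinuousMap σ).comp ⟨stdSimplex.map (SimplexCategory.subinterval (n - q) q (by omega)).toOrderHom,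
        stdSimplex.continuous_map _⟩ :=
  rfl

/-- **The front `p`-face is the affine reparametrisation on the first `p + 1` vertices.** [folklore] -/
theorem frontFace_eq_compose {p : ℕ} (h : p ≤ n) (σ : SingularSimplex X n) :
    σ.frontFace h = σ.compose fun j : Fin (p + 1) ↦ StdSimplex.vtx n (j : ℕ) := by
  apply toContinuousMap_injective
  rw [toContinuousMap_frontFace_eq_comp, toContinuousMap_compose]
  congr 1
  ext t : 1
  change stdSimplex.map _ t = StdSimplex.affComb _ t
  rw [StdSimplex.stdSimplex_map_eq_affComb]
  congr 1
  funext j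
  rw [StdSimplex.vtx_eq_vertex (by omega)]
  rfl

/-- **The back `q`-face is the affine reparametrisation on the last `q + 1` vertices.** [folklore] -/
theorem backFace_eq_compose {q : ℕ} (h : q ≤ n) (σ : SingularSimplex X n) :
    σ.backFace h = σ.compose fun j : Fin (q + 1) ↦ StdSimplex.vtx n ((j : ℕ) + (n - q)) := by
  apply toContinuousMap_injective
  rw [toContinuousMap_backFace_eq_comp, toContinuousMap_compose]
  congr 1
  ext t : 1
  change stdSimplex.map _ t = StdSimplex.affComb _ t
  rw [StdSimplex.stdSimplex_map_eq_affComb]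
  congr 1
  funext j
  rw [StdSimplex.vtx_eq_vertex (by omega)]
  rfl

/-- Front faces of `(σ, τ)`. [folklore] -/
theorem pairSimplex_frontFace {p : ℕ} (h : p ≤ n) (σ : SingularSimplex X n) (τ : SingularSimplex Y n) :
    (pairSimplex σ τ).frontFace h = pairSimplex (σ.frontFace h) (τ.frontFace h) := by
  rw [frontFace_eq_compose, frontFace_eq_compose, frontFace_eq_compose, pairSimplex_compose]

/-- Back faces of `(σ, τ)`. [folklore] -/
theorem pairSimplex_backFace {q : ℕ} (h : q ≤ n) (σ : SingularSimplex X n) (τ : SingularSimplex Y n) :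
    (pairSimplex σ τ).backFace h = pairSimplex (σ.backFace h) (τ.backFace h) := by
  rw [backFace_eq_compose, backFace_eq_compose, backFace_eq_compose, pairSimplex_compose]

/-- **A face is the affine reparametrisation along the skipped vertex labels**: for labels `a ≤ n`,
`(σ ∘ δᵢ) ∘ [e_{a₀}, …] = σ ∘ [e_{δᵢ a₀}, …]`. [folklore] -/
theorem face_compose_vtx (σ : SingularSimplex X (n + 1)) (i : Fin (n + 2)) {a : Fin (k + 1) → ℕ}
    (ha : ∀ j, a j ≤ n) : (σ.face i).compose (fun j ↦ StdSimplex.vtx n (a j)) =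
      σ.compose fun j ↦ StdSimplex.vtx (n + 1) (skip i (a j)) := by
  rw [face_eq_compose, compose_compose]
  congr 1
  funext j
  rw [StdSimplex.vtx_eq_vertex (ha j), StdSimplex.affComb_vertex, StdSimplex.vtx_eq_vertex ?_]
  · congr 1
    exact Fin.ext (val_succAbove i ⟨a j, Nat.lt_succ_of_le (ha j)⟩)
  · have := (Fin.succAbove i ⟨a j, Nat.lt_succ_of_le (ha j)⟩).2
    rw [val_succAbove] at this
    exact Nat.lt_succ_iff.mp this

/-- The front face reparametrised along labels `a ≤ p` is `σ` reparametrised along the same labels. [folklore] -/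
theorem frontFace_compose_vtx {p : ℕ} (h : p ≤ n) (σ : SingularSimplex X n) {a : Fin (k + 1) → ℕ}
    (ha : ∀ j, a j ≤ p) : (σ.frontFace h).compose (fun j ↦ StdSimplex.vtx p (a j)) =
      σ.compose fun j ↦ StdSimplex.vtx n (a j) := by
  rw [frontFace_eq_compose, compose_compose]
  congr 1
  funext j
  rw [StdSimplex.vtx_eq_vertex (ha j), StdSimplex.affComb_vertex]

/-- The back face reparametrised along labels `b ≤ q` is `σ` reparametrised along the labels
`b + (n - q)`. [folklore] -/
theorem backFace_compose_vtx {q : ℕ} (h : q ≤ n) (σ : SingularSimplex X n) {b : Fin (k + 1) → ℕ}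
    (hb : ∀ j, b j ≤ q) : (σ.backFace h).compose (fun j ↦ StdSimplex.vtx q (b j)) =
      σ.compose fun j ↦ StdSimplex.vtx n (b j + (n - q)) := by
  rw [backFace_eq_compose, compose_compose]
  congr 1
  funext j
  rw [StdSimplex.vtx_eq_vertex (hb j), StdSimplex.affComb_vertex]

/-- Reparametrising along the labels `0, 1, …, n` does nothing. [folklore] -/
theorem compose_vtx_val (σ : SingularSimplex X n) :
    σ.compose (fun j : Fin (n + 1) ↦ StdSimplex.vtx n (j : ℕ)) = σ := by
  conv_rhs => rw [← compose_vertexTuple σ]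
  congr 1
  funext j
  exact StdSimplex.vtx_val j

end SingularSimplex

/-! ### Realization of lattice tuple chains against a pair of simplices -/

namespace EilenbergZilber

variable {R : Type v} [CommRing R] {M : Type v} [AddCommGroup M] [Module R M]
variable {X : Type u} [TopologicalSpace X] {Y : Type u} [TopologicalSpace Y]
  {X' : Type u} [TopologicalSpace X'] {Y' : Type u} [TopologicalSpace Y'] {p q k l : ℕ}

open SingularSimplex StdSimplex

/-- The singular `k`-simplex of `X × Y` labelled by a tuple of lattice points
`((a₀,b₀), …, (a_k,b_k))`: `(σ ∘ [e_{a₀}, …, e_{a_k}], τ ∘ [e_{b₀}, …, e_{b_k}])`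
(Eilenberg–Mac Lane: the simplex `(s_ν σ, s_μ τ)` of a shuffle; Hatcher (2002), §3.B p. 278). [cite: HatcherAT2002, §3.B pp. 277–278] -/
def tupleSimplex (σ : SingularSimplex X p) (τ : SingularSimplex Y q) (w : Fin (k + 1) → V) :
    SingularSimplex (X × Y) k :=
  pairSimplex (σ.compose fun j ↦ vtx p (w j).1) (τ.compose fun j ↦ vtx q (w j).2)

/-- Faces of a tuple simplex: delete the label. [folklore] -/
theorem tupleSimplex_face (σ : SingularSimplex X p) (τ : SingularSimplex Y q) (w : Fin (k + 2) → V)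
    (i : Fin (k + 2)) : (tupleSimplex σ τ w).face i = tupleSimplex σ τ (w ∘ Fin.succAbove i) := by
  rw [tupleSimplex, pairSimplex_face, compose_face, compose_face]
  rfl

/-- Tuple simplices are natural in `(X, Y)`. [folklore] -/
theorem tupleSimplex_map (σ : SingularSimplex X p) (τ : SingularSimplex Y q) (w : Fin (k + 1) → V)
    (f : C(X, X')) (g : C(Y, Y')) :
    (tupleSimplex σ τ w).map (f.prodMap g) = tupleSimplex (σ.map f) (τ.map g) w := by
  rw [tupleSimplex, pairSimplex_map_prodMap, ← compose_map, ← compose_map]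
  rfl

/-- **Realization** of tuple chains of lattice points against `(σ, τ)`: `[w] ↦ (m ↦ m • (σ,τ)_w)`,
extended `ℤ`-linearly (the pattern of `SingularSimplex.realize`). [folklore] -/
def realize₂ (R : Type v) [CommRing R] (M : Type v) [AddCommGroup M] [Module R M] (σ : SingularSimplex X p) (τ : SingularSimplex Y q) (k : ℕ) :
    TupleChain V k →ₗ[ℤ] (M →ₗ[R] CChain M (X × Y) k) :=
  Finsupp.lsum ℤ fun w ↦ (LinearMap.id : ℤ →ₗ[ℤ] ℤ).smulRight (Finsupp.lsingle (tupleSimplex σ τ w))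

/-- Realization of an elementary tuple chain. [folklore] -/
theorem realize₂_single (σ : SingularSimplex X p) (τ : SingularSimplex Y q) (w : Fin (k + 1) → V) (z : ℤ) (m : M) :
    realize₂ R M σ τ k (Finsupp.single w z) m = z • Finsupp.single (tupleSimplex σ τ w) m := by
  simp [realize₂]

/-- Realization as a sum over the support. [folklore] -/
theorem realize₂_eq_sum (σ : SingularSimplex X p) (τ : SingularSimplex Y q) (x : TupleChain V k) (m : M) :
    realize₂ R M σ τ k x m = x.sum fun w z ↦ z • (Finsupp.single (tupleSimplex σ τ w) m : CChain M (X × Y) k) := by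
  induction x using Finsupp.induction_linear with
  | zero => simp
  | add x y hx hy =>
    rw [map_add, LinearMap.add_apply, hx, hy, Finsupp.sum_add_index']
    · intro w; simp
    · intro w z z'; simp [add_smul]
  | single w z => rw [realize₂_single, Finsupp.sum_single_index]; simp

/-- **Realization commutes with boundaries** `∂ ((σ,τ)♯ c) = (σ,τ)♯ (∂ c)`. [folklore] -/
theorem bd_realize₂ (σ : SingularSimplex X p) (τ : SingularSimplex Y q) (c : TupleChain V (k + 1)) (m : M) :
    csingularChainComplex.bd R k (realize₂ R M σ τ (k + 1) c m) = realize₂ R M σ τ k (TupleChain.bd k c) m := by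
  induction c using Finsupp.induction_linear with
  | zero => simp
  | add x y hx hy => simp only [map_add, LinearMap.add_apply, hx, hy]
  | single w z =>
    rw [realize₂_single, map_zsmul, csingularChainComplex.bd_single, TupleChain.bd_single, map_sum,
      LinearMap.sum_apply, Finset.smul_sum]
    refine Finset.sum_congr rfl fun i _ ↦ ?_
    rw [map_zsmul, LinearMap.smul_apply, realize₂_single, tupleSimplex_face, neg_one_pow_smul_eq_zsmul, smul_comm]

/-- **Realization is natural**: `(f × g)♯ ((σ,τ)♯ c) = (f ∘ σ, g ∘ τ)♯ c`. [folklore] -/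
theorem map_realize₂ (σ : SingularSimplex X p) (τ : SingularSimplex Y q) (c : TupleChain V k) (m : M)
    (f : C(X, X')) (g : C(Y, Y')) :
    (csingularChainComplex.map R M (f.prodMap g)).f k (realize₂ R M σ τ k c m) =
      realize₂ R M (σ.map f) (τ.map g) k c m := by
  induction c using Finsupp.induction_linear with
  | zero => simp
  | add x y hx hy => simp only [map_add, LinearMap.add_apply, hx, hy]
  | single w z =>
    rw [realize₂_single, realize₂_single, map_zsmul, csingularChainComplex.map_f_single, tupleSimplex_map]

/-- **The realization only sees labels that occur**: if the tuple simplices of `(σ, τ)` on the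
relabelled tuples `g ∘ w` agree with those of `(σ', τ')` on `w` for every tuple `w` of `x`, then
`(σ,τ)♯ (g♯ x) = (σ',τ')♯ x`. [folklore] -/
theorem realize₂_push_eq {p' q' : ℕ} {σ : SingularSimplex X p} {τ : SingularSimplex Y q} {σ' : SingularSimplex X p'}
    {τ' : SingularSimplex Y q'} {x : TupleChain V k} {g : V → V}
    (h : ∀ w ∈ x.support, tupleSimplex σ τ (g ∘ w) = tupleSimplex σ' τ' w) (m : M) :
    realize₂ R M σ τ k (push g k x) m = realize₂ R M σ' τ' k x m := by
  rw [realize₂_eq_sum, realize₂_eq_sum]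
  change (Finsupp.mapDomain _ x).sum _ = _
  rw [Finsupp.sum_mapDomain_index (fun _ ↦ by simp) (fun _ _ _ ↦ by simp [add_smul])]
  exact Finsupp.sum_congr fun w hw ↦ by rw [h w hw]

/-- **Horizontal cofaces become faces of `σ`**: on chains with first labels `≤ n`,
`(σ,τ)♯ ((δᵢ × 1)♯ x) = (σ ∘ δᵢ, τ)♯ x`. [folklore] -/
theorem realize₂_push_faceR {n b : ℕ} (σ : SingularSimplex X (n + 1)) (τ : SingularSimplex Y q) (i : Fin (n + 2))
    {x : TupleChain V k} (hx : VertsIn (box n b) x) (m : M) :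
    realize₂ R M σ τ k (push (faceR i) k x) m = realize₂ R M (σ.face i) τ k x m := by
  refine realize₂_push_eq (fun w hw ↦ ?_) m
  rw [tupleSimplex, tupleSimplex, face_compose_vtx σ i fun j ↦ (hx w hw j).1]
  rfl

/-- **Vertical cofaces become faces of `τ`**: on chains with second labels `≤ n`,
`(σ,τ)♯ ((1 × δⱼ)♯ x) = (σ, τ ∘ δⱼ)♯ x`. [folklore] -/
theorem realize₂_push_faceU {n a : ℕ} (σ : SingularSimplex X p) (τ : SingularSimplex Y (n + 1)) (i : Fin (n + 2))
    {x : TupleChain V k} (hx : VertsIn (box a n) x) (m : M) :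
    realize₂ R M σ τ k (push (faceU i) k x) m = realize₂ R M σ (τ.face i) k x m := by
  refine realize₂_push_eq (fun w hw ↦ ?_) m
  rw [tupleSimplex, tupleSimplex, face_compose_vtx τ i fun j ↦ (hx w hw j).2]
  rfl

/-- **Diagonal cofaces become faces of both**: on chains with labels `≤ n`,
`(σ,τ)♯ ((δᵢ × δᵢ)♯ x) = (σ ∘ δᵢ, τ ∘ δᵢ)♯ x`. [folklore] -/
theorem realize₂_push_dface {n : ℕ} (σ : SingularSimplex X (n + 1)) (τ : SingularSimplex Y (n + 1)) (i : Fin (n + 2))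
    {x : TupleChain V k} (hx : VertsIn (box n n) x) (m : M) :
    realize₂ R M σ τ k (push (dface i) k x) m = realize₂ R M (σ.face i) (τ.face i) k x m := by
  refine realize₂_push_eq (fun w hw ↦ ?_) m
  rw [tupleSimplex, tupleSimplex, face_compose_vtx σ i fun j ↦ (hx w hw j).1, face_compose_vtx τ i fun j ↦ (hx w hw j).2]
  rfl

/-- **The translation `emb p` becomes "front face, back face"**: on chains in the box `[0,p] × [0,q]`,
`p + q = n`, `(σ,σ)♯ ((emb p)♯ x) = (front_p σ, back_q σ)♯ x`. [folklore] -/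
theorem realize₂_push_emb {n : ℕ} (σ : SingularSimplex X n) (hpq : p + q = n) {x : TupleChain V k}
    (hx : VertsIn (box p q) x) (m : M) :
    realize₂ R M σ σ k (push (emb p) k x) m =
      realize₂ R M (σ.frontFace (by omega : p ≤ n)) (σ.backFace (by omega : q ≤ n)) k x m := by
  refine realize₂_push_eq (fun w hw ↦ ?_) m
  rw [tupleSimplex, tupleSimplex, frontFace_compose_vtx _ σ fun j ↦ (hx w hw j).1,
    backFace_compose_vtx _ σ fun j ↦ (hx w hw j).2, show n - q = p by omega]
  rfl

/-- **The diagonal tuple becomes the diagonal simplex** `(σ, σ)`. [folklore] -/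
theorem realize₂_diag {n : ℕ} (σ : SingularSimplex X n) (m : M) :
    realize₂ R M σ σ n (ShuffleChains.diag n) m = Finsupp.single (pairSimplex σ σ) m := by
  rw [ShuffleChains.diag, realize₂_single, one_smul, tupleSimplex]
  simp only [compose_vtx_val]

/-! ### The shuffle product of two simplices -/

variable (R M) in
/-- **The Eilenberg–Zilber / Eilenberg–Mac Lane shuffle product** `σ × τ ∈ Cₙ(X × Y; M)` of a
`p`-simplex of `X` and a `q`-simplex of `Y` (`n = p + q`; for other `n` a junk chain): the signed sum
over the `(p,q)`-shuffles of the simplices `(σ ∘ [e_{a₀},…,e_{aₙ}], τ ∘ [e_{b₀},…,e_{bₙ}])` spanned by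
the lattice paths `((a₀,b₀),…,(aₙ,bₙ))` from `(0,0)` to `(p,q)`, with coefficient `m`
(Eilenberg–Mac Lane 1953, §5; Hatcher (2002), §3.B p. 278). [cite: HatcherAT2002, §3.B pp. 277–278] -/
def ezMap (n : ℕ) (σ : SingularSimplex X p) (τ : SingularSimplex Y q) (m : M) : CChain M (X × Y) n :=
  realize₂ R M σ τ n (shuffle n p) m

/-- The shuffle product is natural: `(f × g)♯ (σ × τ) = (f ∘ σ) × (g ∘ τ)`. [cite: HatcherAT2002, §3.B pp. 277–278] -/
theorem map_ezMap (n : ℕ) (σ : SingularSimplex X p) (τ : SingularSimplex Y q) (m : M) (f : C(X, X')) (g : C(Y, Y')) :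
    (csingularChainComplex.map R M (f.prodMap g)).f n (ezMap R M n σ τ m) = ezMap R M n (σ.map f) (τ.map g) m :=
  map_realize₂ σ τ _ m f g

/-- In degree `0`: `σ × τ = (σ, τ)` for two points. [folklore] -/
theorem ezMap_zero_zero (σ : SingularSimplex X 0) (τ : SingularSimplex Y 0) (m : M) :
    ezMap R M 0 σ τ m = Finsupp.single (pairSimplex σ τ) m := by
  rw [ezMap, shuffle_zero_zero, realize₂_single, one_smul, tupleSimplex]
  congr 2
  · conv_rhs => rw [← compose_vtx_val σ]
    congr 1; funext j; simp [Fin.fin_one_eq_zero j]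
  · conv_rhs => rw [← compose_vtx_val τ]
    congr 1; funext j; simp [Fin.fin_one_eq_zero j]

/-- The horizontal boundary realized: `(σ,τ)♯ (∂ᴿ_{p+1} x) = ∑ᵢ (-1)ⁱ (σ ∘ δᵢ, τ)♯ x`. [folklore] -/
theorem realize₂_bdR {b : ℕ} (σ : SingularSimplex X (p + 1)) (τ : SingularSimplex Y q) {x : TupleChain V k}
    (hx : VertsIn (box p b) x) (m : M) :
    realize₂ R M σ τ k (bdR k (p + 1) x) m =
      ∑ i : Fin (p + 2), ((-1 : R) ^ (i : ℕ)) • realize₂ R M (σ.face i) τ k x m := by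
  rw [bdR_apply, map_sum, LinearMap.sum_apply,
    ← Fin.sum_univ_eq_sum_range (fun i ↦ (realize₂ R M σ τ k) (((-1 : ℤ) ^ i) • push (faceR i) k x) m) (p + 2)]
  refine Finset.sum_congr rfl fun i _ ↦ ?_
  rw [map_zsmul, LinearMap.smul_apply, realize₂_push_faceR σ τ i hx, neg_one_pow_smul_eq_zsmul]

/-- The vertical boundary realized: `(σ,τ)♯ (∂ᵁ_{q+1} x) = ∑ⱼ (-1)ʲ (σ, τ ∘ δⱼ)♯ x`. [folklore] -/
theorem realize₂_bdU {a : ℕ} (σ : SingularSimplex X p) (τ : SingularSimplex Y (q + 1)) {x : TupleChain V k}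
    (hx : VertsIn (box a q) x) (m : M) :
    realize₂ R M σ τ k (bdU k (q + 1) x) m =
      ∑ j : Fin (q + 2), ((-1 : R) ^ (j : ℕ)) • realize₂ R M σ (τ.face j) k x m := by
  rw [bdU_apply, map_sum, LinearMap.sum_apply,
    ← Fin.sum_univ_eq_sum_range (fun j ↦ (realize₂ R M σ τ k) (((-1 : ℤ) ^ j) • push (faceU j) k x) m) (q + 2)]
  refine Finset.sum_congr rfl fun j _ ↦ ?_
  rw [map_zsmul, LinearMap.smul_apply, realize₂_push_faceU σ τ j hx, neg_one_pow_smul_eq_zsmul]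

/-- The diagonal boundary realized: `(σ,τ)♯ (∑ᵢ (-1)ⁱ (δᵢ × δᵢ) x) = ∑ᵢ (-1)ⁱ (σ ∘ δᵢ, τ ∘ δᵢ)♯ x`. [folklore] -/
theorem realize₂_dsum {n : ℕ} (σ : SingularSimplex X (n + 1)) (τ : SingularSimplex Y (n + 1)) {x : TupleChain V k}
    (hx : VertsIn (box n n) x) (m : M) :
    realize₂ R M σ τ k (dsum k (n + 2) x) m =
      ∑ i : Fin (n + 2), ((-1 : R) ^ (i : ℕ)) • realize₂ R M (σ.face i) (τ.face i) k x m := by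
  rw [dsum_apply, map_sum, LinearMap.sum_apply,
    ← Fin.sum_univ_eq_sum_range (fun i ↦ (realize₂ R M σ τ k) (((-1 : ℤ) ^ i) • push (dface i) k x) m) (n + 2)]
  refine Finset.sum_congr rfl fun i _ ↦ ?_
  rw [map_zsmul, LinearMap.smul_apply, realize₂_push_dface σ τ i hx, neg_one_pow_smul_eq_zsmul]

/-- **Boundary of the shuffle product, both factors positive-dimensional**:
`∂(σ × τ) = ∑ᵢ (-1)ⁱ (σ∘δᵢ) × τ + (-1)ᵖ⁺¹ ∑ⱼ (-1)ʲ σ × (τ∘δⱼ)` for a `(p+1)`-simplex `σ` and a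
`(q+1)`-simplex `τ` (Eilenberg–Mac Lane; Hatcher (2002), §3.B, the boundary of the prism triangulation).
[cite: HatcherAT2002, §3.B pp. 277–278] -/
theorem bd_ezMap_succ_succ {n : ℕ} (h : p + q + 1 = n) (σ : SingularSimplex X (p + 1)) (τ : SingularSimplex Y (q + 1))
    (m : M) : csingularChainComplex.bd R n (ezMap R M (n + 1) σ τ m) =
      ∑ i : Fin (p + 2), ((-1 : R) ^ (i : ℕ)) • ezMap R M n (σ.face i) τ m +
        ((-1 : R) ^ (p + 1)) • ∑ j : Fin (q + 2), ((-1 : R) ^ (j : ℕ)) • ezMap R M n σ (τ.face j) m := by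
  subst h
  rw [ezMap, bd_realize₂, bd_shuffle_succ (show p + (q + 1) = p + q + 1 by ring), map_add, map_zsmul,
    LinearMap.add_apply, LinearMap.smul_apply, realize₂_bdR σ τ (by simpa using vertsIn_shuffle (p + q + 1) p) m,
    realize₂_bdU σ τ (by simpa [show p + q + 1 - (p + 1) = q by omega] using vertsIn_shuffle (p + q + 1) (p + 1)) m,
    neg_one_pow_smul_eq_zsmul]
  rfl

/-- **Boundary of the shuffle product with a point on the right**: `∂(σ × τ) = ∑ᵢ (-1)ⁱ (σ∘δᵢ) × τ`. [cite: HatcherAT2002, §3.B pp. 277–278] -/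
theorem bd_ezMap_succ_zero (σ : SingularSimplex X (p + 1)) (τ : SingularSimplex Y 0) (m : M) :
    csingularChainComplex.bd R p (ezMap R M (p + 1) σ τ m) =
      ∑ i : Fin (p + 2), ((-1 : R) ^ (i : ℕ)) • ezMap R M p (σ.face i) τ m := by
  rw [ezMap, bd_realize₂, bd_shuffle_succ (show p + 0 = p by ring), shuffle_eq_zero_of_lt (Nat.lt_succ_self p),
    bdU_zero, smul_zero, add_zero, realize₂_bdR σ τ (by simpa using vertsIn_shuffle p p) m]
  rfl

/-- **Boundary of the shuffle product with a point on the left**: `∂(σ × τ) = ∑ⱼ (-1)ʲ σ × (τ∘δⱼ)`. [cite: HatcherAT2002, §3.B pp. 277–278] -/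
theorem bd_ezMap_zero_succ (σ : SingularSimplex X 0) (τ : SingularSimplex Y (q + 1)) (m : M) :
    csingularChainComplex.bd R q (ezMap R M (q + 1) σ τ m) =
      ∑ j : Fin (q + 2), ((-1 : R) ^ (j : ℕ)) • ezMap R M q σ (τ.face j) m := by
  rw [ezMap, bd_realize₂, bd_shuffle_zero, realize₂_bdU σ τ (by simpa using vertsIn_shuffle q 0) m]
  rfl

/-! ### The Alexander–Whitney ∘ Eilenberg–Zilber diagonal and the Eilenberg–Zilber homotopy -/

variable (R M) in
/-- **The shuffle product of the Alexander–Whitney diagonal** `AW-EZ(σ) = ∑_{p+q=m} (front_p σ) × (back_q σ) ∈ C_m(X × X)`,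
realized from the universal chain `theta m`. [cite: HatcherAT2002, §3.B pp. 277–278] -/
def awMap (σ : SingularSimplex X k) (m : M) : CChain M (X × X) k :=
  realize₂ R M σ σ k (theta k) m

/-- `AW-EZ(σ)` as the sum of shuffle products of front and back faces. [cite: HatcherAT2002, §3.B pp. 277–278] -/
theorem awMap_eq_sum (σ : SingularSimplex X k) (m : M) : awMap R M σ m =
    ∑ x ∈ Finset.antidiagonal k, if h : x.1 + x.2 = k then
      ezMap R M k (σ.frontFace (show x.1 ≤ k by omega)) (σ.backFace (show x.2 ≤ k by omega)) m else 0 := by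
  rw [awMap, theta, map_sum, LinearMap.sum_apply]
  refine Finset.sum_congr rfl fun x hx ↦ ?_
  have h : x.1 + x.2 = k := Finset.mem_antidiagonal.mp hx
  rw [dif_pos h, ezMap, realize₂_push_emb σ h (by simpa [show k - x.1 = x.2 by omega] using vertsIn_shuffle k x.1)]

/-- The vertices of `theta k` have both labels `≤ k`. [folklore] -/
theorem vertsIn_theta (k : ℕ) : VertsIn (box k k) (theta k) := by
  refine VertsIn.sum _ fun x hx ↦ ?_
  have h : x.1 + x.2 = k := Finset.mem_antidiagonal.mp hx
  refine VertsIn.push (fun v hv ↦ ?_) (vertsIn_shuffle k x.1)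
  obtain ⟨h1, h2⟩ := hv
  simp only [box, Set.mem_setOf_eq, emb_apply]
  omega

/-- **`AW-EZ` is a natural chain map**: `∂ AW-EZ(σ) = ∑ᵢ (-1)ⁱ AW-EZ(σ ∘ δᵢ)`. [cite: HatcherAT2002, §3.B pp. 277–278] -/
theorem bd_awMap (σ : SingularSimplex X (k + 1)) (m : M) : csingularChainComplex.bd R k (awMap R M σ m) =
    ∑ i : Fin (k + 2), ((-1 : R) ^ (i : ℕ)) • awMap R M (σ.face i) m := by
  rw [awMap, bd_realize₂, bd_theta, realize₂_dsum σ σ (vertsIn_theta k)]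
  rfl

/-- `AW-EZ` is natural: `(f × f)♯ AW-EZ(σ) = AW-EZ(f ∘ σ)`. [folklore] -/
theorem map_awMap (σ : SingularSimplex X k) (m : M) (f : C(X, X')) :
    (csingularChainComplex.map R M (f.prodMap f)).f k (awMap R M σ m) = awMap R M (σ.map f) m :=
  map_realize₂ σ σ _ m f f

/-- In degree `0`, `AW-EZ(σ) = (σ, σ)`. [folklore] -/
theorem awMap_zero (σ : SingularSimplex X 0) (m : M) : awMap R M σ m = Finsupp.single (pairSimplex σ σ) m := by
  rw [awMap, theta_zero, realize₂_diag]

/-- The vertices of the homotopy chains `D_k` have both labels `≤ k`. [folklore] -/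
theorem vertsIn_homotopyChain : ∀ k : ℕ, VertsIn (box k k) (homotopyChain k)
  | 0 => vertsIn_zero
  | k + 1 => by
    rw [homotopyChain_succ, sub_eq_add_neg, sub_eq_add_neg, ← neg_one_zsmul (theta (k + 1)),
      ← neg_one_zsmul (dsum (k + 1) (k + 2) (homotopyChain k))]
    refine VertsIn.cone (VertsIn.add (VertsIn.add ?_ ((vertsIn_theta (k + 1)).zsmul _)) (VertsIn.zsmul ?_ _))
      (o_mem_box _ _)
    · refine vertsIn_single (fun j ↦ ?_) 1
      have := j.2
      simp only [box, Set.mem_setOf_eq]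
      omega
    · refine VertsIn.sum _ fun i _ ↦ VertsIn.zsmul (VertsIn.push (fun v hv ↦ ?_) (vertsIn_homotopyChain k)) _
      obtain ⟨h1, h2⟩ := hv
      simp only [box, Set.mem_setOf_eq, dface_apply, skip]
      constructor <;> split_ifs <;> omega

variable (R M) in
/-- **The Eilenberg–Zilber homotopy** `H(σ) ∈ C_{k+1}(X × X)` between the diagonal `(σ,σ)` and
`AW-EZ(σ)`, realized from the universal homotopy chains (constructive acyclic models;
Eilenberg–Mac Lane 1953). [cite: HatcherAT2002, §3.B pp. 277–278] -/
def ezHomotopy (σ : SingularSimplex X k) (m : M) : CChain M (X × X) (k + 1) :=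
  realize₂ R M σ σ (k + 1) (homotopyChain k) m

/-- `H` vanishes on points. [folklore] -/
@[simp]
theorem ezHomotopy_zero (σ : SingularSimplex X 0) (m : M) : ezHomotopy R M σ m = 0 := by
  rw [ezHomotopy, homotopyChain_zero, map_zero, LinearMap.zero_apply]

/-- `H` is natural: `(f × f)♯ H(σ) = H(f ∘ σ)`. [folklore] -/
theorem map_ezHomotopy (σ : SingularSimplex X k) (m : M) (f : C(X, X')) :
    (csingularChainComplex.map R M (f.prodMap f)).f (k + 1) (ezHomotopy R M σ m) = ezHomotopy R M (σ.map f) m :=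
  map_realize₂ σ σ _ m f f

/-- **The homotopy formula** `∂ H(σ) = (σ,σ) - AW-EZ(σ) - ∑ᵢ (-1)ⁱ H(σ ∘ δᵢ)` for a
`(k+1)`-simplex `σ` (Eilenberg–Zilber: the diagonal and its Alexander–Whitney approximation followed
by the shuffle map are naturally chain homotopic). [cite: HatcherAT2002, §3.B pp. 277–278] -/
theorem bd_ezHomotopy_succ (σ : SingularSimplex X (k + 1)) (m : M) :
    csingularChainComplex.bd R (k + 1) (ezHomotopy R M σ m) =
      Finsupp.single (pairSimplex σ σ) m - awMap R M σ m -
        ∑ i : Fin (k + 2), ((-1 : R) ^ (i : ℕ)) • ezHomotopy R M (σ.face i) m := by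
  rw [ezHomotopy, bd_realize₂, bd_homotopyChain, map_sub, map_sub, LinearMap.sub_apply, LinearMap.sub_apply,
    realize₂_diag, realize₂_dsum σ σ (vertsIn_homotopyChain k)]
  rfl

/-! ### Linear extension to chains -/

section Chains

variable (R M X)

/-- The diagonal chain map `Δ_* : C_k(X; M) → C_k(X × X; M)`, `σ ↦ (σ, σ)`. [folklore] -/
def diagChain (k : ℕ) : CChain M X k →ₗ[R] CChain M (X × X) k :=
  Finsupp.lsum R fun σ ↦ Finsupp.lsingle (pairSimplex σ σ)

/-- The linear extension of `AW-EZ` to chains. [cite: HatcherAT2002, §3.B pp. 277–278] -/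
def awChain (k : ℕ) : CChain M X k →ₗ[R] CChain M (X × X) k :=
  Finsupp.lsum R fun σ ↦ realize₂ R M σ σ k (theta k)

/-- The linear extension of the Eilenberg–Zilber homotopy to chains. [cite: HatcherAT2002, §3.B pp. 277–278] -/
def ezHChain (k : ℕ) : CChain M X k →ₗ[R] CChain M (X × X) (k + 1) :=
  Finsupp.lsum R fun σ ↦ realize₂ R M σ σ (k + 1) (homotopyChain k)

variable {R M X}

/-- `Δ_*` on an elementary chain. [folklore] -/
@[simp] theorem diagChain_single (σ : SingularSimplex X k) (m : M) :
    diagChain R M X k (Finsupp.single σ m) = Finsupp.single (pairSimplex σ σ) m := by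
  simp [diagChain]
/-- `AW` on an elementary chain. [folklore] -/
@[simp] theorem awChain_single (σ : SingularSimplex X k) (m : M) :
    awChain R M X k (Finsupp.single σ m) = awMap R M σ m := by simp [awChain, awMap]
/-- `H` on an elementary chain. [folklore] -/
@[simp] theorem ezHChain_single (σ : SingularSimplex X k) (m : M) :
    ezHChain R M X k (Finsupp.single σ m) = ezHomotopy R M σ m := by simp [ezHChain, ezHomotopy]

/-- The diagonal chain map is the push-forward along the diagonal. [folklore] -/
theorem diagChain_eq_map (k : ℕ) (c : CChain M X k) : diagChain R M X k c =
    (csingularChainComplex.map R M (⟨fun x ↦ (x, x), continuous_id.prodMk continuous_id⟩ : C(X, X × X))).f k c := by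
  induction c using Finsupp.induction_linear with
  | zero => simp
  | add x y hx hy => simp only [map_add, hx, hy]
  | single σ m => rw [diagChain_single, csingularChainComplex.map_f_single, pairSimplex_self]

/-- **`AW-EZ` is a chain map on chains**: `∂ ∘ AW = AW ∘ ∂`. [cite: HatcherAT2002, §3.B pp. 277–278] -/
theorem bd_awChain (c : CChain M X (k + 1)) :
    csingularChainComplex.bd R k (awChain R M X (k + 1) c) = awChain R M X k (csingularChainComplex.bd R k c) := by
  induction c using Finsupp.induction_linear with
  | zero => simp
  | add x y hx hy => simp only [map_add, hx, hy]
  | single σ m =>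
    rw [awChain_single, bd_awMap, csingularChainComplex.bd_single, map_sum]
    simp only [map_smul, awChain_single]

/-- **The Eilenberg–Zilber homotopy formula on chains**: `∂ H c + H ∂ c = Δ_* c - AW c` in positive
degrees. [cite: HatcherAT2002, §3.B pp. 277–278] -/
theorem bd_ezHChain (c : CChain M X (k + 1)) :
    csingularChainComplex.bd R (k + 1) (ezHChain R M X (k + 1) c) + ezHChain R M X k (csingularChainComplex.bd R k c) =
      diagChain R M X (k + 1) c - awChain R M X (k + 1) c := by
  induction c using Finsupp.induction_linear with
  | zero => simp
  | add x y hx hy =>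
    simp only [map_add]
    rw [add_add_add_comm, hx, hy]
    abel
  | single σ m =>
    rw [ezHChain_single, bd_ezHomotopy_succ, csingularChainComplex.bd_single, map_sum, diagChain_single, awChain_single]
    simp only [map_smul, ezHChain_single]
    abel

/-- In degree `0` the homotopy vanishes and `AW = Δ_*`. [folklore] -/
theorem awChain_zero (c : CChain M X 0) : awChain R M X 0 c = diagChain R M X 0 c := by
  induction c using Finsupp.induction_linear with
  | zero => simp
  | add x y hx hy => simp only [map_add, hx, hy]
  | single σ m => rw [awChain_single, awMap_zero, diagChain_single]

/-- In degree `0` the homotopy vanishes. [folklore] -/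
theorem ezHChain_zero (c : CChain M X 0) : ezHChain R M X 0 c = 0 := by
  induction c using Finsupp.induction_linear with
  | zero => simp
  | add x y hx hy => rw [map_add, hx, hy, add_zero]
  | single σ m => rw [ezHChain_single, ezHomotopy_zero]

/-- **Consequence for cycles**: for a `(k+1)`-cycle `z`, the diagonal `Δ_* z` and `AW z` differ by a
boundary, `Δ_* z - AW z = ∂ (H z)`. [cite: HatcherAT2002, §3.B pp. 277–280] -/
theorem diagChain_sub_awChain_of_bd_eq_zero {z : CChain M X (k + 1)} (hz : csingularChainComplex.bd R k z = 0) :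
    diagChain R M X (k + 1) z - awChain R M X (k + 1) z = csingularChainComplex.bd R (k + 1) (ezHChain R M X (k + 1) z) := by
  rw [← bd_ezHChain, hz, map_zero, add_zero]

end Chains

end EilenbergZilber

end Literature.AlgebraicTopology.SingularHomology
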